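import Literature.ModelTheory.Quasiminimal.Isolation
import HarnessLib

/-!
# Excellence of quasiminimal pregeometry structures (BHHKK 2014, Prop. 6.2)

M. Bays, B. Hart, T. Hyttinen, M. Kesälä, J. Kirby, *Quasiminimal structures and excellence*,
Bull. London Math. Soc. 46 (2014) 155–163, §6. Let `M` be an infinite-dimensional model,
`B ⊆ M` an independent subset of cardinality `ℵ₀` with `M_B = cl(B)`, and `b₁, …, bₙ ∈ B`
distinct; the faces are `∂ᵢM_B = cl(B ∖ {bᵢ})` and the `n`-crown is `∂M_B = ⋃ᵢ ∂ᵢM_B`.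

* **Definition 6.1.** `M` is *excellent* if for every `n ≥ 2`, every `n`-crown `∂M_B` and every
  finite tuple `ā ∈ M_B`, `tp(ā/∂M_B)` is s-isolated.
* **Proposition 6.2.** For each `n ≥ 2`, each `n`-crown `∂M_B` and `ā ∈ M_B`: (i) `tp(ā/∂M_B)`
  is s-isolated, and (ii) if `tp(c̄/∂M_B) = tp(ā/∂M_B)` then there is `π ∈ Aut(M_B/∂M_B)` with
  `π(ā) = c̄`. In particular, `M` is excellent.

We prove Prop. 6.2 for a countable weakly quasiminimal pregeometry structure `M` with a basis
`b : ℕ → M` (an independent family with `cl (range b) = M`, so `M = M_B` is infinite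
dimensional), following BHHKK's induction on `n` verbatim: the swap `π` of `bₙ` with a fresh
`b₀`, isolation of `tp(ā, π(ā)/…)` from Prop. 5.2 (`n = 2`) or the induction hypothesis, the
commutator `η = σπ⁻¹σ⁻¹π` fixing the crown of `M' = cl(B ∖ {b₀})`, and the isomorphism
`φ : M' → M` over `cl(B₀ ∪ {b₁, …, bₙ})`. The induction is run on the sets
`Y_S = crown ∪ {bᵢ : i ∈ S}` for nonempty finite `S ⊆ ℕ` (for `|S| ≥ 2` this is the crown; for
`|S| = 1` it is a face plus its missing basis vector, where (i) is Prop. 5.2 and (ii) is Kirby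
2010, Prop. 2.3).

## Contents

* `face cl b i`, `crown cl b S`, `crownY cl b S`;
* `ExcellentOver L Y` — (i) types of finite tuples over `Y` are s-isolated and (ii) equal types
  over `Y` are conjugate under `Aut(M/Y)`;
* `IsWeaklyQuasiminimalPregeometryStructure.excellentOver_crown` — Prop. 6.2.

## References

* M. Bays, B. Hart, T. Hyttinen, M. Kesälä, J. Kirby, *Quasiminimal structures and excellence*,
  Bull. London Math. Soc. 46 (2014) 155–163, arXiv:1210.2008: Def. 6.1, Prop. 6.2.
* J. Kirby, *On quasiminimal excellent classes*, J. Symbolic Logic 75 (2010), Def. 1.1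
  (crowns, axiom III).
-/

noncomputable section

open Set FirstOrder FirstOrder.Language
open scoped Matroid

universe u v w

namespace Literature.ModelTheory.Quasiminimal

variable {L : Language.{u, v}} {M : Type w} [L.Structure M] {cl : Set M → Set M}

/-! ### Automorphisms: compositions and transport of types -/

section Automorphisms

/-- Composition of automorphisms. [folklore] -/
theorem isQFEmbOn_trans {σ τ : M ≃ M} (hσ : IsQFEmbOn L σ univ) (hτ : IsQFEmbOn L τ univ) :
    IsQFEmbOn L (σ.trans τ) univ :=
  hσ.comp (by rw [image_univ, σ.surjective.range_eq]; exact hτ)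

/-- **Transport of types along a partial embedding** defined on a set containing the
parameters and the tuples. [folklore] -/
theorem _root_.FirstOrder.Language.EqQFTypeOver.image_of_isQFEmbOn_on {θ : M → M} {D P : Set M}
    (hθ : IsQFEmbOn L θ D) (hP : P ⊆ D) {n : ℕ} {x y : Fin n → M} (hx : ∀ i, x i ∈ D)
    (hy : ∀ i, y i ∈ D) (h : L.EqQFTypeOver P id x y) :
    L.EqQFTypeOver (θ '' P) id (θ ∘ x) (θ ∘ y) := by
  intro m σ' hσ'
  choose σ hσP hσ using hσ'
  have hxm : ∀ i, Fin.append σ x i ∈ D := fun i => by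
    refine Fin.addCases (fun j => ?_) (fun j => ?_) i
    · simpa using hP (hσP j)
    · simpa using hx j
  have hym : ∀ i, Fin.append σ y i ∈ D := fun i => by
    refine Fin.addCases (fun j => ?_) (fun j => ?_) i
    · simpa using hP (hσP j)
    · simpa using hy j
  have h1 := hθ (Fin.append σ x) hxm
  have h2 := hθ (Fin.append σ y) hym
  have ex : θ ∘ Fin.append σ x = Fin.append σ' (θ ∘ x) := by
    funext i
    refine Fin.addCases (fun j => ?_) (fun j => ?_) i
    · simpa using hσ j
    · simp
  have ey : θ ∘ Fin.append σ y = Fin.append σ' (θ ∘ y) := by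
    funext i
    refine Fin.addCases (fun j => ?_) (fun j => ?_) i
    · simpa using hσ j
    · simp
  rw [ex] at h1
  rw [ey] at h2
  have key := h σ hσP
  simp only [Function.id_comp] at key ⊢
  exact (h1.symm.trans key).trans h2

end Automorphisms

namespace IsWeaklyQuasiminimalPregeometryStructure

/-- **Basis-change automorphisms** (Kirby 2010, Thm 2.1 with `f₀ = id_G`): in a countable weakly
quasiminimal pregeometry structure, if `G` is closed (or empty) and `u`, `u'` are families
independent over `G` each spanning `M` together with `G`, there is an automorphism of `M` fixing
`G` pointwise with `u i ↦ u' i`. [cite: Kirby2010QMEC, Thm 2.1] -/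
theorem exists_equiv_of_indepFamilies [Countable M]
    (hW : IsWeaklyQuasiminimalPregeometryStructure L M cl) {G : Set M} (hG : cl G = G ∨ G = ∅)
    {ι : Type*} {u u' : ι → M} (hu : IndepFamilyOver cl G u) (hu' : IndepFamilyOver cl G u')
    (hsp : cl (G ∪ range u) = univ) (hsp' : cl (G ∪ range u') = univ) :
    ∃ σ : M ≃ M, IsQFEmbOn L σ univ ∧ (∀ x ∈ G, σ x = x) ∧ ∀ i, σ (u i) = u' i := by
  have hG' : (cl G = G ∧ cl (id '' G) = id '' G) ∨ G = ∅ := by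
    rcases hG with h | h
    · exact Or.inl ⟨h, by rwa [image_id]⟩
    · exact Or.inr h
  have hu'' : IndepFamilyOver cl (id '' G) u' := by rwa [image_id]
  obtain ⟨F, hF, hFid, hFu, hFim⟩ :=
    hW.exists_isQFEmbOn_extend_indepFamily hG' (IsQFEmbOn.id G) hu hu''
  rw [hsp] at hF
  rw [hsp, image_id, hsp', image_univ] at hFim
  have hbij : Function.Bijective F :=
    ⟨fun a b hab => hF.injOn (mem_univ a) (mem_univ b) hab, fun b => by
      have : b ∈ range F := hFim.symm ▸ mem_univ b
      exact this⟩
  exact ⟨Equiv.ofBijective F hbij, hF, fun x hx => hFid hx, hFu⟩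

end IsWeaklyQuasiminimalPregeometryStructure

/-! ### Faces and crowns of a basis -/

section Crowns

variable (cl)

/-- The **face** `∂ᵢM_B = cl (B ∖ {bᵢ})` of the basis `b : ℕ → M` (BHHKK 2014 §6).
[cite: BHHKK2014, §6 (before Def. 6.1)] -/
def face (b : ℕ → M) (i : ℕ) : Set M := cl (b '' {j | j ≠ i})

/-- The **crown** `∂M_B = ⋃_{i ∈ S} ∂ᵢM_B` of the basis `b` determined by the finite set of
indices `S` (an `|S|`-crown; BHHKK 2014 §6, Kirby 2010 Def. 1.1). [cite: BHHKK2014, §6 (before Def. 6.1)] -/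
def crown (b : ℕ → M) (S : Finset ℕ) : Set M := ⋃ i ∈ S, face cl b i

/-- The crown together with the basis vectors it is indexed by: `Y_S = ∂M_B ∪ {bᵢ : i ∈ S}`
(equal to the crown when `|S| ≥ 2`; for `S = {i}` it is `∂ᵢM_B ∪ {bᵢ}`). The induction of
BHHKK 2014, Prop. 6.2 runs on these sets. [folklore] -/
def crownY (b : ℕ → M) (S : Finset ℕ) : Set M := crown cl b S ∪ b '' ↑S

variable {cl}

variable {b : ℕ → M}

/-- Faces are closed. [folklore] -/
theorem cl_face (h : IsPregeometry cl) (b : ℕ → M) (i : ℕ) : cl (face cl b i) = face cl b i :=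
  h.cl_cl _

/-- `bⱼ ∈ ∂ᵢ` for `j ≠ i`. [folklore] -/
theorem apply_mem_face (h : IsPregeometry cl) {i j : ℕ} (hji : j ≠ i) : b j ∈ face cl b i :=
  h.subset_cl _ ⟨j, hji, rfl⟩

/-- `bᵢ ∉ ∂ᵢ` for an independent family. [folklore] -/
theorem apply_notMem_face (hb : IndepFamilyOver cl ∅ b) (i : ℕ) : b i ∉ face cl b i := by
  have := hb i
  rwa [empty_union] at this

/-- Faces lie in the crown. [folklore] -/
theorem face_subset_crown {S : Finset ℕ} {i : ℕ} (hi : i ∈ S) : face cl b i ⊆ crown cl b S :=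
  subset_biUnion_of_mem (u := fun i => face cl b i) hi

/-- Membership in a crown. [folklore] -/
theorem mem_crown_iff {S : Finset ℕ} {x : M} : x ∈ crown cl b S ↔ ∃ i ∈ S, x ∈ face cl b i := by
  simp only [crown, mem_iUnion, exists_prop]

/-- Crowns are monotone in the index set. [folklore] -/
theorem crown_mono {S T : Finset ℕ} (h : T ⊆ S) : crown cl b T ⊆ crown cl b S := fun x hx => by
  obtain ⟨i, hi, hx⟩ := mem_crown_iff.1 hx
  exact mem_crown_iff.2 ⟨i, h hi, hx⟩

/-- A basis vector `bⱼ` lies in the crown as soon as `S` has an index other than `j`. [folklore] -/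
theorem apply_mem_crown (h : IsPregeometry cl) {S : Finset ℕ} {i j : ℕ} (hi : i ∈ S)
    (hji : j ≠ i) : b j ∈ crown cl b S :=
  face_subset_crown hi (apply_mem_face h hji)

/-- For `|S| ≥ 2` the crown contains the basis vectors it is indexed by. [folklore] -/
theorem image_subset_crown (h : IsPregeometry cl) {S : Finset ℕ} (hS : 2 ≤ S.card) :
    b '' ↑S ⊆ crown cl b S := by
  rintro _ ⟨j, hj, rfl⟩
  obtain ⟨i, hi, hij⟩ : ∃ i ∈ S, i ≠ j := by
    by_contra hcon
    push Not at hcon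
    have : S ⊆ {j} := fun i hi => Finset.mem_singleton.2 (hcon i hi)
    have := Finset.card_le_card this
    rw [Finset.card_singleton] at this
    omega
  exact apply_mem_crown h hi hij.symm

/-- For `|S| ≥ 2`, `Y_S` is the crown. [folklore] -/
theorem crownY_eq_crown (h : IsPregeometry cl) {S : Finset ℕ} (hS : 2 ≤ S.card) :
    crownY cl b S = crown cl b S :=
  union_eq_self_of_subset_right (image_subset_crown h hS)

/-- `Y_{i} = ∂ᵢ ∪ {bᵢ}`. [folklore] -/
theorem crownY_singleton (i : ℕ) : crownY cl b {i} = face cl b i ∪ range ![b i] := by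
  simp [crownY, crown, Matrix.range_cons, Matrix.range_empty]

/-- Sub-families of an independent family are independent over the closure of a disjoint part
of the family. [folklore] -/
theorem IndepFamilyOver.comp_of_disjoint (h : IsPregeometry cl) (hb : IndepFamilyOver cl ∅ b)
    (P : Set ℕ) {ι : Type*} {g : ι → ℕ} (hg : Function.Injective g) (hgP : ∀ i, g i ∉ P) :
    IndepFamilyOver cl (cl (b '' P)) (b ∘ g) := by
  intro i hi
  rw [h.cl_cl_union] at hi
  refine hb (g i) ?_
  rw [empty_union]
  refine h.mono ?_ hi
  rintro _ (⟨j, hj, rfl⟩ | ⟨k, hk, rfl⟩)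
  · exact ⟨j, fun hji => hgP i (by rw [← (hji : j = g i)]; exact hj), rfl⟩
  · exact ⟨g k, fun hki => hk (hg hki), rfl⟩

/-- The closure of the whole basis from a closed part and the rest:
`cl (cl (b '' P) ∪ b '' Q) = univ` when `P ∪ Q = univ` and `cl (range b) = univ`. [folklore] -/
theorem cl_cl_image_union_image (h : IsPregeometry cl) (hsp : cl (range b) = univ) {P Q : Set ℕ}
    (hPQ : ∀ j, j ∈ P ∨ j ∈ Q) : cl (cl (b '' P) ∪ b '' Q) = univ := by
  rw [h.cl_cl_union, ← image_union]
  have : P ∪ Q = univ := eq_univ_of_forall fun j => hPQ j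
  rw [this, image_univ, hsp]

end Crowns

/-! ### The excellence predicate -/

section Excellent

variable (L)

/-- **Excellence over a set `Y`** (the two clauses of BHHKK 2014, Prop. 6.2, for `Y` a crown):
(i) for every finite tuple `x̄` the type `tp(x̄/Y)` is s-isolated (determined by its restriction
to a finite `A₀ ⊆ Y`), and (ii) tuples with the same type over `Y` are conjugate by an
automorphism of `M` fixing `Y` pointwise. [cite: BHHKK2014, Prop. 6.2] -/
def ExcellentOver (Y : Set M) : Prop :=
  (∀ ⦃m : ℕ⦄ (x : Fin m → M), ∃ A₀ : Set M, A₀.Finite ∧ A₀ ⊆ Y ∧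
      ∀ c : Fin m → M, L.EqQFTypeOver A₀ id x c → L.EqQFTypeOver Y id x c) ∧
    ∀ ⦃m : ℕ⦄ (x c : Fin m → M), L.EqQFTypeOver Y id x c →
      ∃ π : M ≃ M, IsQFEmbOn L π univ ∧ (∀ y ∈ Y, π y = y) ∧ ∀ j, π (x j) = c j

variable {L}

end Excellent

/-! ### The base of the induction: a face and its basis vector -/

namespace IsWeaklyQuasiminimalPregeometryStructure

variable {b : ℕ → M}

/-- **Base case** (`|S| = 1`): over `Y_{i} = ∂ᵢ ∪ {bᵢ}`, (i) is BHHKK Prop. 5.2 with `C = ∂ᵢ`,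
`ā = bᵢ`, and (ii) is Kirby 2010, Prop. 2.3 over the closed set `∂ᵢ`.
[cite: BHHKK2014, Prop. 6.2 (proof, case n = 2)] -/
theorem excellentOver_crownY_singleton [Countable M]
    (hW : IsWeaklyQuasiminimalPregeometryStructure L M cl) (hsp : cl (range b) = univ) (i : ℕ) :
    ExcellentOver L (crownY cl b {i}) := by
  have hP := hW.isPregeometry
  have hC : cl (face cl b i) = face cl b i := cl_face hP b i
  have huniv : cl (face cl b i ∪ range ![b i]) = univ := by
    rw [face, hP.cl_cl_union, Matrix.range_cons, Matrix.range_empty, union_empty, ← image_singleton,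
      ← image_union]
    have : {j | j ≠ i} ∪ {i} = (univ : Set ℕ) := by
      ext j; by_cases h : j = i <;> simp [h]
    rw [this, image_univ, hsp]
  rw [crownY_singleton]
  refine ⟨fun m x => ?_, fun m x c hxc => ?_⟩
  · obtain ⟨A₀, hA₀fin, hA₀, hiso⟩ := hW.exists_isolation hC ![b i] (b := x)
      (fun j => by rw [huniv]; exact mem_univ _)
    exact ⟨A₀, hA₀fin, hA₀, hiso⟩
  · have h1 : L.EqQFTypeOver (face cl b i) id (Fin.append ![b i] x) (Fin.append ![b i] c) :=
      hxc.append_of_union_range.append_swap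
    obtain ⟨σ, hσ, hσC, hσx⟩ := hW.exists_equiv_of_eqQFTypeOver (Or.inl hC) h1
    refine ⟨σ, hσ, ?_, fun j => by simpa using hσx (Fin.natAdd 1 j)⟩
    rintro y (hy | ⟨k, rfl⟩)
    · exact hσC y hy
    · have := hσx (Fin.castAdd m k)
      simp only [Fin.append_left] at this
      exact this

/-! ### The induction step (BHHKK 2014, proof of Prop. 6.2) -/

/-- **Induction step of BHHKK 2014, Prop. 6.2.** If `Y_T` is excellent for `T = S ∖ {iₙ}` (with
some `i₁ ∈ T`), then `Y_S` is excellent. This is the body of BHHKK's proof: given `ā`, choose a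
fresh `b_{i₀}` with `ā ∈ M' = cl(B ∖ {b_{i₀}})`, the swap `π ∈ Aut(M/cl(B ∖ {b_{i₀}, b_{iₙ}}))`
of `b_{i₀}` and `b_{iₙ}`, and `A₀ ⊇ π(ā)` isolating `tp(ā/Y_T ∪ π(ā))`; for `c̄` with
`tp(c̄/A₀) = tp(ā/A₀)` get `σ ∈ Aut(M/Y_T ∪ π(ā))` with `σ(ā) = c̄`, the commutator
`η = σπ⁻¹σ⁻¹π ∈ Aut(M/∂M')` with `η(ā) = c̄`, and an isomorphism `φ : M' → M` over
`cl(b[B₀ ∪ S])` carrying `∂M'` onto `∂M`; then `tp(c̄/∂M) = tp(ā/∂M)` and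
`θ = φ η φ⁻¹ ∈ Aut(M/∂M)` maps `ā ↦ c̄`. [cite: BHHKK2014, Prop. 6.2 (proof)] -/
theorem excellentOver_crownY_step [Countable M]
    (hW : IsWeaklyQuasiminimalPregeometryStructure L M cl) (hb : IndepFamilyOver cl ∅ b)
    (hsp : cl (range b) = univ) {S : Finset ℕ} {iₙ i₁ : ℕ} (hiₙ : iₙ ∈ S) (hi₁ : i₁ ∈ S)
    (hne : i₁ ≠ iₙ) (IH : ExcellentOver L (crownY cl b (S.erase iₙ))) :
    ExcellentOver L (crownY cl b S) := by
  classical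
  have hP := hW.isPregeometry
  have hbinj : Function.Injective b := hb.injective hP
  haveI : Nonempty M := ⟨b 0⟩
  set T := S.erase iₙ with hT
  have hi₁T : i₁ ∈ T := Finset.mem_erase.2 ⟨hne, hi₁⟩
  have hTS : T ⊆ S := Finset.erase_subset _ _
  have hS2 : 2 ≤ S.card := Finset.one_lt_card.2 ⟨i₁, hi₁, iₙ, hiₙ, hne⟩
  -- automorphisms fixing `Y_T` fix the whole basis pointwise; `Y_T ⊆ ∂M_S`
  have hYT_b : ∀ j, b j ∈ crownY cl b T := by
    intro j
    by_cases hj : j = i₁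
    · subst hj; exact Or.inr ⟨j, by simpa using hi₁T, rfl⟩
    · exact Or.inl (apply_mem_crown hP hi₁T hj)
  have hYT_S : crownY cl b T ⊆ crown cl b S := by
    rintro y (hy | ⟨j, hj, rfl⟩)
    · exact crown_mono hTS hy
    · exact apply_mem_crown hP hiₙ (Finset.mem_erase.1 hj).1
  have hYS : crownY cl b S = crown cl b S := crownY_eq_crown hP hS2
  -- one tuple at a time
  suffices key : ∀ {m : ℕ} (a : Fin m → M), ∃ A₀ : Set M, A₀.Finite ∧ A₀ ⊆ crown cl b S ∧
      ∀ c : Fin m → M, L.EqQFTypeOver A₀ id a c →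
        L.EqQFTypeOver (crown cl b S) id a c ∧
          ∃ θ : M ≃ M, IsQFEmbOn L θ univ ∧ (∀ y ∈ crown cl b S, θ y = y) ∧ ∀ j, θ (a j) = c j by
    rw [hYS]
    refine ⟨fun m a => ?_, fun m a c hac => ?_⟩
    · obtain ⟨A₀, h1, h2, h3⟩ := key a
      exact ⟨A₀, h1, h2, fun c hc => (h3 c hc).1⟩
    · obtain ⟨A₀, -, h2, h3⟩ := key a
      exact (h3 c (eqQFTypeOver_id_mono h2 hac)).2
  intro m a
  -- (C1) a finite part of the basis supporting `ā`, and a fresh index `i₀`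
  have hsupp : ∀ j, ∃ F : Finset ℕ, a j ∈ cl (b '' ↑F) := by
    intro j
    have : a j ∈ cl (range b) := by rw [hsp]; exact mem_univ _
    obtain ⟨A, hA, hAfin, hjA⟩ := hP.finite_character this
    refine ⟨(hAfin.preimage hbinj.injOn).toFinset, hP.mono ?_ hjA⟩
    intro x hx
    obtain ⟨k, rfl⟩ := hA hx
    exact ⟨k, by simpa using hx, rfl⟩
  choose F hF using hsupp
  set Fa : Finset ℕ := Finset.univ.biUnion F with hFa
  have haFa : ∀ j, a j ∈ cl (b '' ↑Fa) := fun j => by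
    refine hP.mono (image_mono fun k hk => ?_) (hF j)
    exact Finset.mem_coe.2 (Finset.mem_biUnion.2 ⟨j, Finset.mem_univ _, hk⟩)
  obtain ⟨i₀, hi₀⟩ := Infinite.exists_notMem_finset (S ∪ Fa)
  have hi₀S : i₀ ∉ S := fun h => hi₀ (Finset.mem_union_left _ h)
  have hi₀Fa : i₀ ∉ Fa := fun h => hi₀ (Finset.mem_union_right _ h)
  have hi₀iₙ : i₀ ≠ iₙ := fun h => hi₀S (h ▸ hiₙ)
  have hi₀i₁ : i₀ ≠ i₁ := fun h => hi₀S (h ▸ hi₁)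
  set P : Set ℕ := ↑Fa ∪ ↑S with hPdef
  have hPi₀ : ∀ j ∈ P, j ≠ i₀ := by
    rintro j (hj | hj) rfl
    · exact hi₀Fa hj
    · exact hi₀S hj
  have hSP : (↑S : Set ℕ) ⊆ P := subset_union_right
  have hPfin : P.Finite := Fa.finite_toSet.union S.finite_toSet
  set M' : Set M := cl (b '' {j | j ≠ i₀}) with hM'
  set G₀ : Set M := cl (b '' {j | j ≠ i₀ ∧ j ≠ iₙ}) with hG₀
  set G₁ : Set M := cl (b '' P) with hG₁
  have hG₁cl : cl G₁ = G₁ := hP.cl_cl _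
  have haG₁ : ∀ j, a j ∈ G₁ := fun j => hP.mono (image_mono subset_union_left) (haFa j)
  have hG₁M' : G₁ ⊆ M' := hP.mono (image_mono fun j hj => hPi₀ j hj)
  have haM' : ∀ j, a j ∈ M' := fun j => hG₁M' (haG₁ j)
  -- (C2) the swap `π` of `b i₀` and `b iₙ` over `G₀`
  let g : Bool → ℕ := fun t => if t then i₀ else iₙ
  let g' : Bool → ℕ := fun t => if t then iₙ else i₀
  have hg : Function.Injective g := by
    intro s t h; cases s <;> cases t <;> simp [g, hi₀iₙ, hi₀iₙ.symm] at h ⊢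
  have hg' : Function.Injective g' := by
    intro s t h; cases s <;> cases t <;> simp [g', hi₀iₙ, hi₀iₙ.symm] at h ⊢
  have hgQ : ∀ t, g t ∉ {j | j ≠ i₀ ∧ j ≠ iₙ} := fun t => by cases t <;> simp [g]
  have hg'Q : ∀ t, g' t ∉ {j | j ≠ i₀ ∧ j ≠ iₙ} := fun t => by cases t <;> simp [g']
  have hspg : ∀ j, j ∈ {j | j ≠ i₀ ∧ j ≠ iₙ} ∨ j ∈ range g := fun j => by
    by_cases h1 : j = i₀
    · exact Or.inr ⟨true, h1 ▸ rfl⟩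
    · by_cases h2 : j = iₙ
      · exact Or.inr ⟨false, h2 ▸ rfl⟩
      · exact Or.inl ⟨h1, h2⟩
  have hspg' : ∀ j, j ∈ {j | j ≠ i₀ ∧ j ≠ iₙ} ∨ j ∈ range g' := fun j => by
    by_cases h1 : j = i₀
    · exact Or.inr ⟨false, h1 ▸ rfl⟩
    · by_cases h2 : j = iₙ
      · exact Or.inr ⟨true, h2 ▸ rfl⟩
      · exact Or.inl ⟨h1, h2⟩
  obtain ⟨π, hπ, hπG₀, hπu⟩ : ∃ π : M ≃ M, IsQFEmbOn L π univ ∧ (∀ x ∈ G₀, π x = x) ∧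
      ∀ t, π ((b ∘ g) t) = (b ∘ g') t := by
    refine hW.exists_equiv_of_indepFamilies (Or.inl (hP.cl_cl _))
      (IndepFamilyOver.comp_of_disjoint hP hb _ hg hgQ)
      (IndepFamilyOver.comp_of_disjoint hP hb _ hg' hg'Q) ?_ ?_
    · rw [range_comp]; exact cl_cl_image_union_image hP hsp hspg
    · rw [range_comp]; exact cl_cl_image_union_image hP hsp hspg'
  have hπi₀ : π (b i₀) = b iₙ := hπu true
  have hπiₙ : π (b iₙ) = b i₀ := hπu false
  have hπb : ∀ j, j ≠ i₀ → j ≠ iₙ → π (b j) = b j := fun j h1 h2 =>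
    hπG₀ _ (hP.subset_cl _ ⟨j, ⟨h1, h2⟩, rfl⟩)
  have hπsymm_i₀ : π.symm (b iₙ) = b i₀ := π.symm_apply_eq.2 hπi₀.symm
  have hπsymm_iₙ : π.symm (b i₀) = b iₙ := π.symm_apply_eq.2 hπiₙ.symm
  -- `π` permutes `b[Q]` whenever `Q` contains both or neither of `i₀`, `iₙ`
  have hπ_img : ∀ Q : Set ℕ, (i₀ ∈ Q ↔ iₙ ∈ Q) → (π : M → M) '' (b '' Q) = b '' Q := by
    intro Q hQ
    ext y
    constructor
    · rintro ⟨_, ⟨j, hj, rfl⟩, rfl⟩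
      by_cases h1 : j = i₀
      · subst h1; exact ⟨iₙ, hQ.1 hj, hπi₀.symm⟩
      · by_cases h2 : j = iₙ
        · subst h2; exact ⟨i₀, hQ.2 hj, hπiₙ.symm⟩
        · exact ⟨j, hj, (hπb j h1 h2).symm⟩
    · rintro ⟨j, hj, rfl⟩
      by_cases h1 : j = i₀
      · subst h1; exact ⟨b iₙ, ⟨iₙ, hQ.1 hj, rfl⟩, hπiₙ⟩
      · by_cases h2 : j = iₙ
        · subst h2; exact ⟨b i₀, ⟨i₀, hQ.2 hj, rfl⟩, hπi₀⟩
        · exact ⟨b j, ⟨j, hj, rfl⟩, hπb j h1 h2⟩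
  have hπ_cl : ∀ Q : Set ℕ, (i₀ ∈ Q ↔ iₙ ∈ Q) → (π : M → M) '' cl (b '' Q) = cl (b '' Q) :=
    fun Q hQ => by rw [equiv_image_cl hW hπ, hπ_img Q hQ]
  have hπM' : (π : M → M) '' M' = face cl b iₙ := by
    rw [hM', equiv_image_cl hW hπ, face]
    congr 1
    ext y
    constructor
    · rintro ⟨_, ⟨j, hj, rfl⟩, rfl⟩
      by_cases h2 : j = iₙ
      · subst h2; exact ⟨i₀, hi₀iₙ, hπiₙ.symm⟩
      · exact ⟨j, h2, (hπb j hj h2).symm⟩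
    · rintro ⟨j, hj, rfl⟩
      by_cases h1 : j = i₀
      · subst h1; exact ⟨b iₙ, ⟨iₙ, hi₀iₙ.symm, rfl⟩, hπiₙ⟩
      · exact ⟨b j, ⟨j, h1, rfl⟩, hπb j h1 hj⟩
  have hπa : ∀ j, π (a j) ∈ face cl b iₙ := fun j =>
    hπM' ▸ mem_image_of_mem (π : M → M) (haM' j)
  -- (C3) isolation of `tp(ā, π(ā)/Y_T)` from the induction hypothesis
  obtain ⟨A₀', hA₀'fin, hA₀'Y, hiso⟩ := IH.1 (Fin.append ((π : M → M) ∘ a) a)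
  refine ⟨A₀' ∪ range ((π : M → M) ∘ a), hA₀'fin.union (finite_range _),
    union_subset (hA₀'Y.trans hYT_S) ?_, fun c hc => ?_⟩
  · rintro _ ⟨j, rfl⟩
    exact face_subset_crown hiₙ (hπa j)
  -- s1–s3: the automorphism `σ` over `Y_T ∪ π(ā)` with `σ(ā) = c̄`
  have h1 : L.EqQFTypeOver A₀' id (Fin.append ((π : M → M) ∘ a) a)
      (Fin.append ((π : M → M) ∘ a) c) := hc.append_of_union_range.append_swap
  have h2 := hiso _ h1
  obtain ⟨σ, hσ, hσY, hσx⟩ := IH.2 _ _ h2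
  have hσπa : ∀ j, σ (π (a j)) = π (a j) := fun j => by
    simpa using hσx (Fin.castAdd m j)
  have hσa : ∀ j, σ (a j) = c j := fun j => by
    have := hσx (Fin.natAdd m j)
    rwa [Fin.append_right, Fin.append_right] at this
  have hσb : ∀ j, σ (b j) = b j := fun j => hσY _ (hYT_b j)
  have hσ_img : ∀ Q : Set ℕ, (σ : M → M) '' (b '' Q) = b '' Q := fun Q =>
    (image_congr fun y hy => by obtain ⟨j, -, rfl⟩ := hy; exact hσb j).trans (image_id _)
  have hσ_cl : ∀ Q : Set ℕ, (σ : M → M) '' cl (b '' Q) = cl (b '' Q) := fun Q => by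
    rw [equiv_image_cl hW hσ, hσ_img]
  have hcG₁ : ∀ j, c j ∈ G₁ := fun j => by
    rw [← hσa j]
    have := mem_image_of_mem (σ : M → M) (haG₁ j)
    rwa [hσ_cl] at this
  have hcM' : ∀ j, c j ∈ M' := fun j => hG₁M' (hcG₁ j)
  -- s4: the commutator `η = σ π⁻¹ σ⁻¹ π`
  let η : M ≃ M := ((π.trans σ.symm).trans π.symm).trans σ
  have hη : IsQFEmbOn L η univ :=
    isQFEmbOn_trans (isQFEmbOn_trans (isQFEmbOn_trans hπ (isQFEmbOn_symm hσ)) (isQFEmbOn_symm hπ)) hσ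
  have hη_apply : ∀ x, η x = σ (π.symm (σ.symm (π x))) := fun x => rfl
  have hηa : ∀ j, η (a j) = c j := fun j => by
    rw [hη_apply, σ.symm_apply_eq.2 (hσπa j).symm, Equiv.symm_apply_apply, hσa]
  have hσsymm_b : ∀ j, σ.symm (b j) = b j := fun j => σ.symm_apply_eq.2 (hσb j).symm
  have hηb : ∀ j, η (b j) = b j := fun j => by
    rw [hη_apply]
    by_cases h1 : j = i₀
    · subst h1; rw [hπi₀, hσsymm_b, hπsymm_i₀, hσb]
    · by_cases h2 : j = iₙ
      · subst h2; rw [hπiₙ, hσsymm_b, hπsymm_iₙ, hσb]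
      · rw [hπb j h1 h2, hσsymm_b, π.symm_apply_eq.2 (hπb j h1 h2).symm, hσb]
  have hη_cl : ∀ Q : Set ℕ, (η : M → M) '' cl (b '' Q) = cl (b '' Q) := fun Q => by
    rw [equiv_image_cl hW hη]
    congr 1
    exact (image_congr fun y hy => by obtain ⟨j, -, rfl⟩ := hy; exact hηb j).trans (image_id _)
  -- the crown of `M'`: `∂M' = ⋃_{i ∈ S} cl (B ∖ {b_{i₀}, bᵢ})`, fixed pointwise by `η`
  set D' : Set M := ⋃ i ∈ S, cl (b '' {j | j ≠ i₀ ∧ j ≠ i}) with hD'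
  have hD'M' : D' ⊆ M' := iUnion₂_subset fun i _ => hP.mono (image_mono fun j hj => hj.1)
  have hface_T : ∀ i ∈ S, i ≠ iₙ → face cl b i ⊆ crownY cl b T := fun i hi hin =>
    (face_subset_crown (Finset.mem_erase.2 ⟨hin, hi⟩)).trans subset_union_left
  have hηD' : ∀ x ∈ D', η x = x := by
    intro x hx
    obtain ⟨i, hi, hx⟩ := mem_iUnion₂.1 hx
    rw [hη_apply]
    by_cases hin : i = iₙ
    · subst hin
      have hπx : π x = x := hπG₀ x hx
      have hsx : σ.symm x ∈ G₀ := by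
        have : σ.symm x ∈ (σ.symm : M → M) '' G₀ := mem_image_of_mem _ hx
        rwa [Equiv.symm_image_eq_of_image_eq (hσ_cl _)] at this
      rw [hπx, π.symm_apply_eq.2 (hπG₀ _ hsx).symm, Equiv.apply_symm_apply]
    · have hi₀i : i ≠ i₀ := fun h => hi₀S (h ▸ hi)
      have hxf : x ∈ face cl b i := hP.mono (image_mono fun j hj => hj.2) hx
      have hπx : π x ∈ face cl b i := by
        have hπf : (π : M → M) '' face cl b i = face cl b i :=
          hπ_cl {j | j ≠ i} ⟨fun _ => fun h => hin h.symm, fun _ => fun h => hi₀i h.symm⟩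
        rw [← hπf]
        exact mem_image_of_mem _ hxf
      rw [σ.symm_apply_eq.2 (hσY _ (hface_T i hi hin hπx)).symm, Equiv.symm_apply_apply,
        hσY _ (hface_T i hi hin hxf)]
  -- s5: `tp(ā/∂M') = tp(c̄/∂M')`
  have h5 : L.EqQFTypeOver D' id a c := by
    have := eqQFTypeOver_id_of_isQFEmbOn hη hηD' a
    rwa [show (η : M → M) ∘ a = c from funext hηa] at this
  -- s7: the isomorphism `φ : M' → M` over `G₁`
  let ι := {j : ℕ // j ≠ i₀ ∧ j ∉ P}
  let ι' := {j : ℕ // j ∉ P}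
  have hιinf : Infinite ι := by
    have : ({j : ℕ | j ≠ i₀ ∧ j ∉ P}).Infinite := by
      have := (hPfin.insert i₀).infinite_compl
      refine this.mono ?_
      intro j hj
      simp only [mem_compl_iff, mem_insert_iff, not_or] at hj
      exact hj
    exact this.to_subtype
  have hι'inf : Infinite ι' := by
    have : ({j : ℕ | j ∉ P}).Infinite := hPfin.infinite_compl.mono fun j hj => hj
    exact this.to_subtype
  obtain ⟨dι⟩ := nonempty_denumerable ι
  obtain ⟨dι'⟩ := nonempty_denumerable ι'
  let e : ι ≃ ι' := (Denumerable.eqv ι).trans (Denumerable.eqv ι').symm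
  let u : ι → M := fun j => b j.1
  let u' : ι → M := fun j => b (e j).1
  have hu : IndepFamilyOver cl G₁ u :=
    IndepFamilyOver.comp_of_disjoint hP hb P (g := fun j : ι => j.1) Subtype.val_injective
      fun j => j.2.2
  have hu' : IndepFamilyOver cl (id '' G₁) u' := by
    rw [image_id]
    exact IndepFamilyOver.comp_of_disjoint hP hb P (g := fun j : ι => (e j).1)
      (Subtype.val_injective.comp e.injective) fun j => (e j).2
  obtain ⟨φ, hφ, hφG₁, hφu, hφim⟩ := hW.exists_isQFEmbOn_extend_indepFamily (G := G₁) (f := id)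
    (Or.inl ⟨hG₁cl, by rw [image_id]; exact hG₁cl⟩) (IsQFEmbOn.id G₁) hu hu'
  have hru : range u = b '' {j | j ≠ i₀ ∧ j ∉ P} := by
    ext y; constructor
    · rintro ⟨j, rfl⟩; exact ⟨j.1, j.2, rfl⟩
    · rintro ⟨j, hj, rfl⟩; exact ⟨⟨j, hj⟩, rfl⟩
  have hru' : range u' = b '' {j | j ∉ P} := by
    ext y; constructor
    · rintro ⟨j, rfl⟩; exact ⟨(e j).1, (e j).2, rfl⟩
    · rintro ⟨j, hj, rfl⟩; exact ⟨e.symm ⟨j, hj⟩, by simp [u']⟩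
  have hdom : cl (G₁ ∪ range u) = M' := by
    rw [hru, hG₁, hP.cl_cl_union, ← image_union, hM']
    congr 2
    ext j
    simp only [mem_union, mem_setOf_eq]
    constructor
    · rintro (hj | hj)
      · exact hPi₀ j hj
      · exact hj.1
    · intro hj
      by_cases hjP : j ∈ P
      · exact Or.inl hjP
      · exact Or.inr ⟨hj, hjP⟩
  have himφ : cl (id '' G₁ ∪ range u') = univ := by
    rw [image_id, hru', hG₁]
    exact cl_cl_image_union_image hP hsp fun j => by by_cases h : j ∈ P <;> simp [h]
  rw [hdom] at hφ
  rw [hdom, himφ] at hφim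
  have hφa : ∀ j, φ (a j) = a j := fun j => hφG₁ (haG₁ j)
  have hφc : ∀ j, φ (c j) = c j := fun j => hφG₁ (hcG₁ j)
  have hφbP : ∀ j ∈ P, φ (b j) = b j := fun j hj => hφG₁ (hP.subset_cl _ ⟨j, hj, rfl⟩)
  -- s8: transport along `φ`: `φ(∂M') = ∂M`
  have hφD' : φ '' D' = crown cl b S := by
    rw [hD', image_iUnion₂, crown]
    refine iUnion₂_congr fun i hi => ?_
    rw [hφ.image_cl_eq hW (hP.mono (image_mono fun j hj => hj.1))
      (by rw [hφim]; exact subset_univ _), face]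
    congr 1
    ext y
    constructor
    · rintro ⟨_, ⟨j, ⟨hj₀, hji⟩, rfl⟩, rfl⟩
      by_cases hjP : j ∈ P
      · exact ⟨j, hji, (hφbP j hjP).symm⟩
      · refine ⟨(e ⟨j, hj₀, hjP⟩).1, fun h => (e ⟨j, hj₀, hjP⟩).2 (h ▸ hSP hi), ?_⟩
        exact (hφu ⟨j, hj₀, hjP⟩).symm
    · rintro ⟨k, hki, rfl⟩
      by_cases hkP : k ∈ P
      · exact ⟨b k, ⟨k, ⟨hPi₀ k hkP, hki⟩, rfl⟩, hφbP k hkP⟩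
      · let j : ι := e.symm ⟨k, hkP⟩
        refine ⟨b j.1, ⟨j.1, ⟨j.2.1, fun h => j.2.2 (h ▸ hSP hi)⟩, rfl⟩, ?_⟩
        have := hφu j
        simpa [u, u', j] using this
  have h8 : L.EqQFTypeOver (crown cl b S) id a c := by
    have := h5.image_of_isQFEmbOn_on hφ hD'M' haM' hcM'
    rwa [hφD', show (φ ∘ a) = a from funext hφa, show (φ ∘ c) = c from funext hφc] at this
  refine ⟨h8, ?_⟩
  -- s9: `θ = φ η φ⁻¹ ∈ Aut(M/∂M)` with `θ(ā) = c̄`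
  set ψ := Function.invFunOn φ M' with hψ
  have hψφ : ∀ x ∈ M', ψ (φ x) = x := fun x hx => hφ.injOn.leftInvOn_invFunOn hx
  have hφψ : ∀ y, ψ y ∈ M' ∧ φ (ψ y) = y := fun y =>
    Function.invFunOn_pos (by
      have : y ∈ φ '' M' := hφim.symm ▸ mem_univ y
      obtain ⟨x, hx, rfl⟩ := this
      exact ⟨x, hx, rfl⟩)
  have hηM' : (η : M → M) '' M' = M' := hη_cl _
  have hψemb : IsQFEmbOn L ψ univ := by
    have := hφ.inverse hψφ
    rwa [hφim] at this
  let θ₀ : M → M := fun y => φ (η (ψ y))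
  have hθ₀ : IsQFEmbOn L θ₀ univ := by
    have h1 : IsQFEmbOn L ((η : M → M) ∘ ψ) univ := hψemb.comp (hη.mono (subset_univ _))
    refine h1.comp (hφ.mono ?_)
    rintro _ ⟨y, -, rfl⟩
    rw [← hηM']
    exact mem_image_of_mem _ (hφψ y).1
  have hθ₀φ : ∀ x ∈ M', θ₀ (φ x) = φ (η x) := fun x hx => by
    change φ (η (ψ (φ x))) = φ (η x)
    rw [hψφ x hx]
  have hbij : Function.Bijective θ₀ := by
    refine ⟨fun y₁ y₂ h => hθ₀.injOn (mem_univ _) (mem_univ _) h, fun y => ?_⟩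
    obtain ⟨x, hx, rfl⟩ : y ∈ φ '' M' := hφim.symm ▸ mem_univ y
    obtain ⟨x', hx', rfl⟩ : x ∈ (η : M → M) '' M' := hηM'.symm ▸ hx
    exact ⟨φ x', hθ₀φ x' hx'⟩
  refine ⟨Equiv.ofBijective θ₀ hbij, hθ₀, fun y hy => ?_, fun j => ?_⟩
  · obtain ⟨x, hx, rfl⟩ : y ∈ φ '' D' := hφD'.symm ▸ hy
    change θ₀ (φ x) = φ x
    rw [hθ₀φ x (hD'M' hx), hηD' x hx]
  · change φ (η (ψ (a j))) = c j
    have : ψ (a j) = a j := by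
      conv_lhs => rw [← hφa j]
      exact hψφ _ (haM' j)
    rw [this, hηa, hφc]

/-- **BHHKK 2014, Prop. 6.2 on the sets `Y_S`**: for every nonempty finite set of indices `S`,
`Y_S = ∂M_S ∪ {bᵢ : i ∈ S}` is excellent (induction on `|S|`, base `|S| = 1`).
[cite: BHHKK2014, Prop. 6.2] -/
theorem excellentOver_crownY [Countable M]
    (hW : IsWeaklyQuasiminimalPregeometryStructure L M cl) (hb : IndepFamilyOver cl ∅ b)
    (hsp : cl (range b) = univ) {S : Finset ℕ} (hS : S.Nonempty) :
    ExcellentOver L (crownY cl b S) := by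
  classical
  -- induction on the cardinality
  suffices ∀ n (S : Finset ℕ), S.card = n + 1 → ExcellentOver L (crownY cl b S) by
    obtain ⟨n, hn⟩ : ∃ n, S.card = n + 1 := ⟨S.card - 1, by
      have := Finset.card_pos.2 hS; omega⟩
    exact this n S hn
  intro n
  induction n with
  | zero =>
    intro S hS1
    obtain ⟨i, rfl⟩ := Finset.card_eq_one.1 hS1
    exact hW.excellentOver_crownY_singleton hsp i
  | succ n ih =>
    intro S hScard
    obtain ⟨iₙ, hiₙ⟩ : S.Nonempty := Finset.card_pos.1 (by omega)
    have hTcard : (S.erase iₙ).card = n + 1 := by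
      rw [Finset.card_erase_of_mem hiₙ, hScard]; rfl
    obtain ⟨i₁, hi₁T⟩ : (S.erase iₙ).Nonempty := Finset.card_pos.1 (by omega)
    obtain ⟨hne, hi₁⟩ := Finset.mem_erase.1 hi₁T
    exact hW.excellentOver_crownY_step hb hsp hiₙ hi₁ hne (ih _ hTcard)

/-- **BHHKK 2014, Prop. 6.2 (excellence).** Let `M` be a countable weakly quasiminimal
pregeometry structure with a basis `b : ℕ → M` (independent, `cl (range b) = M`), and let
`S` be a finite set of at least two indices, with crown `∂M_S = ⋃_{i ∈ S} cl (b[ℕ ∖ {i}])`. Then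
(i) for every finite tuple `ā`, `tp(ā/∂M_S)` is s-isolated: there is a finite `A₀ ⊆ ∂M_S` with
`tp(c̄/A₀) = tp(ā/A₀) ⟹ tp(c̄/∂M_S) = tp(ā/∂M_S)`; and (ii) if `tp(c̄/∂M_S) = tp(ā/∂M_S)` then
some `π ∈ Aut(M/∂M_S)` maps `ā ↦ c̄`. In particular `M` is excellent (Def. 6.1).
[cite: BHHKK2014, Prop. 6.2] -/
theorem excellentOver_crown [Countable M]
    (hW : IsWeaklyQuasiminimalPregeometryStructure L M cl) (hb : IndepFamilyOver cl ∅ b)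
    (hsp : cl (range b) = univ) {S : Finset ℕ} (hS : 2 ≤ S.card) :
    ExcellentOver L (crown cl b S) := by
  have := hW.excellentOver_crownY hb hsp (S := S) (Finset.card_pos.1 (by omega))
  rwa [crownY_eq_crown hW.isPregeometry hS] at this

end IsWeaklyQuasiminimalPregeometryStructure

end Literature.ModelTheory.Quasiminimal

end
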